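import Literature.Computability.QuantumComplexity.RazTalMaskedUniform
import HarnessLib

/-!
# The Raz–Tal `BQP^O` machine reading the Forrelation window through the `1·`-half of the oracle

Topic `Literature/Computability/QuantumComplexity`; variant of `RazTalBlocks.lean` /
`RazTalMachine.lean` / `RazTalMachineUniform.lean` (Raz–Tal, *Oracle separation of BQP and PH*,
J. ACM 69 (2022), App. A: the uniform `BQP^O` machine running the amplified one-query Forrelation
test `Q₁` on the level-`n` window of the oracle) in the style of the masked variant
`RazTalMasked*.lean`. Here the single oracle query of each block is asked with the seed wire `o` of
the block — which holds the constant `1` after the classical prefix (`IncInv.seed`) — PREPENDED to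
the query wires, so that the queried string is `1 · rtAddr n i k` and block `i` reads bit `k` of
block `i` of the level-`n` window of

  `preLang O = {s | 1s ∈ O}`,   i.e. of the SECOND component of a join `O = K ⊕ G`
  (`oracleJoin K G`: `0w ↦ [w ∈ K]`, `1w ↦ [w ∈ G]`, so `preLang (K ⊕ G) = G`).

The whole amplitude analysis of `RazTalBlocks.lean` applies verbatim with `O` replaced by
`preLang O` (`seg4P_mulVec`), the global layout, pre-processing, token count and read-out of
`RazTalMachine.lean` are reused unchanged (`acceptProb_bigCircP : acceptProb = q1Accept n (pWindow O n)`),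
and uniformity is the generator-program argument of `RazTalMachineUniform.lean` with the oracle
token stream of the block changed (`descGP`, `rtFamilyP_isUniform`). Main result:

* **`razTalPrefixed_bqpMachine`** — for every threshold `n₀` and table `tbl`, a polynomial-time
  uniform family of Clifford+T circuits with oracle gates accepting `x` with probability `tbl |x|`
  below `n₀` and with probability exactly `q1Accept |x| (pWindow O |x|) = q1Accept |x| (rtWindow
  (preLang O) |x|)` from `n₀` on.

**Why.** Relative to a join `K ⊕ G` with a fixed base `K` (a `PSPACE`-complete set, or the brain
oracle of the tree's Fortnow–Rogers world `FortnowRogersBrainWorld.lean`) the original machine reads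
a window half of whose bits are frozen bits of `K`; the prefixed machine reads the window of the
generic part `G` alone. It is the quantum side of the relativized failure of the promise lift
`BQP ⊆ BPP ⟹ PromiseBQP ⊆ PromiseBPP'` (`Literature/Barriers/QuantumAdvantage/PromiseLiftRelativization.lean`).

Contents: `preLang`, `pWindow`; in `namespace RazTalMachine`: the block program `queryWiresP`,
`quantOpsP`, `blockOpsP` (well-formedness, wire bounds), the block circuit `QlocP`, the query on
configurations (`queryOf_cfgP`, `oracleP_mulVec_Dvec/dState`, `seg4P_mulVec`),
`compileList_quantOpsP_mulVec`, `QlocP_mulVec_zero`, `sum_ite_normSq_QlocP`, `blockWindow_preLang`;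
the machine `blocksOpsP`, `allOpsP`, `bigCircP`, `compileList_blocksOpsP`, `blocksP_mulVec`,
`acceptProb_bigCircP`, the family `rtFamilyP`, `prefixedMachine_of_isUniform`; uniformity
(`namespace RtGen`: `oracleGP`, `blockGP`, `descGP`, `out_*`, `render_out_descGP`, hygiene,
`descBigP_mem_FP`), `rtFamilyP_isUniform`; and `razTalPrefixed_bqpMachine`.

## References

* R. Raz, A. Tal, *Oracle separation of BQP and PH*, J. ACM 69 (2022), Art. 30, App. A, Claim 8.1,
  §2.2, §6 [RazTalJACM2022].
* S. Aaronson, A. Ambainis, *Forrelation*, SIAM J. Comput. 47 (2018), Prop. 6 [AaronsonAmbainis2018].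
* M. A. Nielsen, I. L. Chuang, *Quantum Computation and Quantum Information*, CUP 2010, §2.1.7
  eq. (2.45), §3.2.5, §6.1.1 [NielsenChuang2010].
* S. Arora, B. Barak, *Computational Complexity: A Modern Approach*, CUP 2009, §6.1–§6.2, proof of
  Thm. 6.15 (uniform generation of descriptions) [AroraBarak2009].
* L. Fortnow, J. Rogers, *Complexity limitations on quantum computation*, JCSS 59 (1999), proof of
  Thm. 4.2 (the join `H ⊕ G`) [FortnowRogers1999JCSS].
-/

noncomputable section

namespace Literature.Computability.QuantumComplexity

open _root_.Computability Complexity Cryptography Literature.Probability.RandomGraphs.LowDegree Matrix Finset RevSim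

/-! ### The `1·`-half of a language -/

/-- **The `1·`-half**: `s ∈ preLang O ↔ 1s ∈ O` (for `O = K ⊕ G`, `preLang O = G`). [folklore] -/
def preLang (A : Language Bool) : Language Bool := {s | true :: s ∈ A}

/-- The indicator of `preLang O`. [folklore] -/
theorem boolIndicator_preLang (A : Language Bool) (s : List Bool) :
    (preLang A).boolIndicator s = A.boolIndicator (true :: s) := by
  by_cases h : true :: s ∈ A
  · rw [(Set.mem_iff_boolIndicator _ _).1 h, (Set.mem_iff_boolIndicator _ _).1 (show s ∈ preLang A from h)]
  · rw [(Set.notMem_iff_boolIndicator _ _).1 h, (Set.notMem_iff_boolIndicator _ _).1 (show s ∉ preLang A from h)]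

/-- **The `1·`-window of an oracle language at level `n`**: bit `(i, k)` is `[1 · rtAddr n i k ∈ O]`. [folklore] -/
def pWindow (A : Language Bool) (n : ℕ) : Window n :=
  fun i k => A.boolIndicator (true :: rtAddr n i k)

/-- The window of the `1·`-half is the `1·`-window. [folklore] -/
theorem rtWindow_preLang (A : Language Bool) (n : ℕ) : rtWindow (preLang A) n = pWindow A n := by
  funext i k
  exact boolIndicator_preLang A _

namespace RazTalMachine

/-! ### The block program with the prefixed query -/

section Program

variable (n L : ℕ)

/-- The query wires of the prefixed block: the seed wire `o` first, then address and index bits. [folklore] -/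
def queryWiresP : List ℕ := oW n :: queryWires n L

/-- **The quantum part of a prefixed block**: as `quantOps`, with the oracle query on `queryWiresP`. [folklore] -/
def quantOpsP : List (RtOp ℕ) :=
  [RtOp.cl (ClOp.not (tW n)), RtOp.had (tW n)] ++ (List.range (n + 1)).map RtOp.had ++
    [RtOp.oracle (queryWiresP n L) (tW n)] ++ (List.range n).map (RtOp.chad (hW n)) ++ [RtOp.had (hW n)]

/-- **The program of prefixed block `i`.** [folklore] -/
def blockOpsP (i : ℕ) : List (RtOp ℕ) := (prefixOps n L i).map RtOp.cl ++ quantOpsP n L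

variable {n L}

/-- Membership in the prefixed query wires. [folklore] -/
theorem mem_queryWiresP {w : ℕ} : w ∈ queryWiresP n L ↔ w = oW n ∨ w < n + 1 ∨ ∃ l, l < L ∧ w = bW n l := by
  rw [queryWiresP, List.mem_cons, mem_queryWires]

/-- The prefixed query wires and the target are pairwise distinct. [folklore] -/
theorem nodup_queryWiresP_target : (queryWiresP n L ++ [tW n]).Nodup := by
  have h := nodup_queryWires_target (n := n) (L := L)
  rw [List.nodup_append] at h ⊢
  obtain ⟨hq, -, hqt⟩ := h
  refine ⟨?_, List.nodup_singleton _, ?_⟩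
  · rw [queryWiresP, List.nodup_cons]
    refine ⟨fun ha => ?_, hq⟩
    rcases mem_queryWires.1 ha with h | ⟨l, -, h⟩
    · unfold oW at h; omega
    · unfold bW oW at h; omega
  · intro a ha b hb
    rw [List.mem_singleton] at hb
    subst hb
    rcases mem_queryWiresP.1 ha with rfl | h | ⟨l, -, rfl⟩
    · unfold oW tW; omega
    · unfold tW; omega
    · unfold bW tW; omega

/-- The prefixed quantum part is well formed. [folklore] -/
theorem quantOpsP_wf : ∀ op ∈ quantOpsP n L, op.WF := by
  intro op hop
  simp only [quantOpsP, List.mem_append, List.mem_cons, List.mem_map, List.mem_range, List.not_mem_nil, or_false] at hop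
  rcases hop with ((((rfl | rfl) | ⟨l, -, rfl⟩) | rfl) | ⟨l, hl, rfl⟩) | rfl
  · trivial
  · trivial
  · trivial
  · exact nodup_queryWiresP_target
  · change hW n ≠ l; unfold hW; omega
  · trivial

/-- The wires of the prefixed quantum part: address, target, seed, index bits. [folklore] -/
theorem quantOpsP_wires {op : RtOp ℕ} (hop : op ∈ quantOpsP n L) {w : ℕ} (hw : w ∈ op.wires) :
    w ≤ n + 2 ∨ ∃ l, l < L ∧ w = bW n l := by
  simp only [quantOpsP, List.mem_append, List.mem_cons, List.mem_map, List.mem_range, List.not_mem_nil, or_false] at hop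
  rcases hop with ((((rfl | rfl) | ⟨l, hl, rfl⟩) | rfl) | ⟨l, hl, rfl⟩) | rfl
  · simp only [RtOp.wires, mem_wiresOf, ClOp.target, ClOp.controls, List.not_mem_nil, or_false] at hw
    rw [hw]; exact Or.inl (by unfold tW; omega)
  · simp only [RtOp.wires, List.mem_singleton] at hw
    rw [hw]; exact Or.inl (by unfold tW; omega)
  · simp only [RtOp.wires, List.mem_singleton] at hw
    rw [hw]; exact Or.inl (by omega)
  · simp only [RtOp.wires, List.mem_append, List.mem_singleton] at hw
    rcases hw with hw | hw
    · rcases mem_queryWiresP.1 hw with h | h | h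
      · rw [h]; exact Or.inl (by unfold oW; omega)
      · exact Or.inl (by omega)
      · exact Or.inr h
    · rw [hw]; exact Or.inl (by unfold tW; omega)
  · simp only [RtOp.wires, List.mem_cons, List.not_mem_nil, or_false] at hw
    rcases hw with h | h
    · rw [h]; exact Or.inl (by unfold hW; omega)
    · rw [h]; exact Or.inl (by omega)
  · simp only [RtOp.wires, List.mem_singleton] at hw
    rw [hw]; exact Or.inl (by unfold hW; omega)

/-- The prefixed block program is well formed. [folklore] -/
theorem blockOpsP_wf (i : ℕ) : ∀ op ∈ blockOpsP n L i, op.WF := by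
  intro op hop
  simp only [blockOpsP, List.mem_append, List.mem_map] at hop
  rcases hop with ⟨op', hop', rfl⟩ | hop
  · exact prefixOps_wf i op' hop'
  · exact quantOpsP_wf op hop

/-- The wires of the prefixed block program are below `Bsz`. [folklore] -/
theorem blockOpsP_lt {i : ℕ} (hi : i ≤ rtBlocks n) : ∀ op ∈ blockOpsP n L i, ∀ w ∈ op.wires, w < Bsz n L := by
  intro op hop w hw
  simp only [blockOpsP, List.mem_append, List.mem_map] at hop
  rcases hop with ⟨op', hop', rfl⟩ | hop
  · exact (prefixOps_wires hi hop' hw).2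
  · rcases quantOpsP_wires hop hw with h | ⟨l, hl, rfl⟩
    · unfold Bsz; omega
    · exact bW_lt_Bsz hl

end Program

/-- **The circuit of prefixed block `i`** on its own `Bsz n L` wires. [folklore] -/
def QlocP (n L : ℕ) (i : Fin (rtBlocks n)) : QCircuit cliffordT (Bsz n L) :=
  ⟨RtOp.compileList ((blockOpsP n L i).map (RtOp.map (foB n L)))
    (wf_map_finOf_of (Bsz_pos n L) (blockOpsP_wf (n := n) (L := L) i) (blockOpsP_lt (le_of_lt i.isLt)))⟩

/-! ### The prefixed query on configurations -/

section Quantum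

variable {n L : ℕ} (c : QReg (Bsz n L)) (A : Language Bool)

/-- **The query string of the prefixed oracle gate at a configuration**: the seed bit of `c`, then
the address bits and the index bits of `c`. [cite: NielsenChuang2010, §6.1.1] -/
theorem queryOf_cfgP (y : Fin (n + 1) → Bool) (tb : Bool)
    (h : (((queryWiresP n L).map (foB n L)) ++ [ft n L]).Nodup) :
    queryOf (oracleEmb ((queryWiresP n L).map (foB n L)) (ft n L) h) (cfg c y tb) =
      c (fo (n := n) (L := L)) :: (List.ofFn y ++ (List.range L).map fun l => c (foB n L (bW n l))) := by
  unfold queryOf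
  have e1 : (List.ofFn fun j : Fin ((queryWiresP n L).map (foB n L)).length =>
      cfg c y tb (oracleEmb ((queryWiresP n L).map (foB n L)) (ft n L) h j.castSucc)) =
      List.ofFn fun j : Fin ((queryWiresP n L).map (foB n L)).length =>
        cfg c y tb (((queryWiresP n L).map (foB n L))[j.val]) := by
    congr 1
    funext j
    rw [oracleEmb_castSucc]
  have e2 : ((queryWiresP n L).map (foB n L)).map (cfg c y tb) =
      c (fo (n := n) (L := L)) :: (List.ofFn y ++ (List.range L).map fun l => c (foB n L (bW n l))) := by
    rw [queryWiresP, queryWires, List.map_cons, List.map_cons, List.map_append, List.map_append, List.map_map,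
      List.map_map, List.map_map]
    congr 1
    · exact cfg_apply_of_le c y tb (by rw [show foB n L (oW n) = fo from rfl, val_fo])
    · congr 1
      · rw [map_range_eq_map_finRange, List.ofFn_eq_map]
        refine List.map_congr_left fun j _ => ?_
        exact cfg_apply_aEmb c y tb j
      · refine List.map_congr_left fun l hl => ?_
        rw [List.mem_range] at hl
        simp only [Function.comp_apply]
        exact cfg_apply_of_le c y tb (by rw [val_foB (bW_lt_Bsz hl)]; unfold bW; omega)
  rw [e1, List.ofFn_getElem_eq_map, e2]

/-- One prefixed oracle gate on `Dvec`: the phase `(−1)^{[c o · query ∈ O]}`. [cite: NielsenChuang2010, §6.1.1 Eq. (6.4)] -/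
theorem oracleP_mulVec_Dvec (y : Fin (n + 1) → Bool) (h : (((queryWiresP n L).map (foB n L)) ++ [ft n L]).Nodup) :
    (QGate.oracle ((queryWiresP n L).map (foB n L)).length (oracleEmb ((queryWiresP n L).map (foB n L)) (ft n L) h) :
        QGate cliffordT (Bsz n L)).toMatrix A *ᵥ Dvec c y =
      sgnC (A.boolIndicator (c fo :: (List.ofFn y ++ (List.range L).map fun l => c (foB n L (bW n l))))) • Dvec c y := by
  have key : ∀ tb, (QGate.oracle ((queryWiresP n L).map (foB n L)).length
      (oracleEmb ((queryWiresP n L).map (foB n L)) (ft n L) h) : QGate cliffordT (Bsz n L)).toMatrix A *ᵥ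
        basisState (cfg c y tb) = basisState (cfg c y
          (tb ^^ A.boolIndicator (c fo :: (List.ofFn y ++ (List.range L).map fun l => c (foB n L (bW n l)))))) := by
    intro tb
    rw [QGate.toMatrix_oracle, placeGate_oracleGate_mulVec_basisState, oracleTarget, oracleEmb_last, queryOf_cfgP,
      cfg_apply_ft, update_cfg_ft]
  rw [Dvec, Matrix.mulVec_sub, key, key]
  cases A.boolIndicator (c fo :: (List.ofFn y ++ (List.range L).map fun l => c (foB n L (bW n l)))) <;> simp [sgnC]

/-- One prefixed oracle gate on `dState`. [cite: NielsenChuang2010, §6.1.1 Eq. (6.4)] -/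
theorem oracleP_mulVec_dState (β : (Fin (n + 1) → Bool) → ℂ) (h : (((queryWiresP n L).map (foB n L)) ++ [ft n L]).Nodup) :
    (QGate.oracle ((queryWiresP n L).map (foB n L)).length (oracleEmb ((queryWiresP n L).map (foB n L)) (ft n L) h) :
        QGate cliffordT (Bsz n L)).toMatrix A *ᵥ dState c β =
      dState c (fun y => sgnC (A.boolIndicator (c fo :: (List.ofFn y ++ (List.range L).map fun l =>
        c (foB n L (bW n l))))) * β y) := by
  unfold dState
  rw [Matrix.mulVec_sum]
  exact Finset.sum_congr rfl fun y _ => by rw [Matrix.mulVec_smul, oracleP_mulVec_Dvec, smul_smul, mul_comm]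

/-- **The prefixed query segment**: on a configuration with seed `1`, the query applies the phase of
`preLang O`: `dState c β ↦ dState c (χ̂_{preLang O} · β)`. [cite: NielsenChuang2010, §6.1.1 Eq. (6.4)] -/
theorem seg4P_mulVec (hseed : c fo = true)
    (hX : ∀ op ∈ [RtOp.oracle ((queryWiresP n L).map (foB n L)) (ft n L)], op.WF)
    (β : (Fin (n + 1) → Bool) → ℂ) :
    (⟨RtOp.compileList [RtOp.oracle ((queryWiresP n L).map (foB n L)) (ft n L)] hX⟩ : QCircuit cliffordT (Bsz n L)).toMatrix A *ᵥ
      dState c β = dState c (fun y => sgnC (chi c (preLang A) y) * β y) := by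
  rw [RtOp.compileList_cons, RtOp.compileList, List.append_nil, RtOp.compile, QCircuit.toMatrix_cons,
    QCircuit.toMatrix_nil, Matrix.one_mul, oracleP_mulVec_dState]
  congr 1
  funext y
  rw [hseed, chi, boolIndicator_preLang]

end Quantum

/-! ### Composition of the prefixed quantum part -/

section Compose

variable {n L : ℕ} (c : QReg (Bsz n L)) (A : Language Bool)
variable (hc : ∀ p : Fin (Bsz n L), (p : ℕ) < n + 2 → c p = false)
include hc

/-- **The prefixed quantum part on the prefix state** (seed `1`): the compiled operations map the
basis state `c` to `2^{-(n+2)/2} ∑_y blockAmp_{preLang O}(y) (|cfg y 0⟩ − |cfg y 1⟩)` — the final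
state of the original block for the language `preLang O`. [cite: RazTalJACM2022, §2.2 and §6] -/
theorem compileList_quantOpsP_mulVec (hseed : c fo = true)
    (h : ∀ op ∈ (quantOpsP n L).map (RtOp.map (foB n L)), op.WF) :
    (⟨RtOp.compileList ((quantOpsP n L).map (RtOp.map (foB n L))) h⟩ : QCircuit cliffordT (Bsz n L)).toMatrix A *ᵥ
        basisState c = invSqrt2 ^ (n + 2) • dState c (blockAmp c (preLang A)) := by
  have hsplit : (quantOpsP n L).map (RtOp.map (foB n L)) =
      ([RtOp.cl (ClOp.not (ft n L)), RtOp.had (ft n L)] ++ ((List.range (n + 1)).map (foB n L)).map RtOp.had) ++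
        ([RtOp.oracle ((queryWiresP n L).map (foB n L)) (ft n L)] ++
          (((List.range n).map (foB n L)).map (RtOp.chad (fh n L)) ++ [RtOp.had (fh n L)])) := by
    simp [quantOpsP, RtOp.map, ClOp.map, ft, fh, List.map_map, Function.comp_def]
  rw [RtOp.compileList_congr hsplit h (fun op hop => h op (hsplit ▸ hop)), RtOp.compileList_append,
    RtOp.compileList_append, RtOp.compileList_append, RtOp.compileList_append]
  rw [toMatrix_mk_append, toMatrix_mk_append, toMatrix_mk_append, toMatrix_mk_append]
  simp only [Matrix.mul_assoc]
  simp only [← Matrix.mulVec_mulVec]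
  rw [seg12_mulVec c A hc, Matrix.mulVec_smul, seg3_mulVec, smul_smul, ← pow_succ', Matrix.mulVec_smul,
    seg4P_mulVec c A hseed, Matrix.mulVec_smul, Matrix.mulVec_smul, seg5_mulVec, seg6_mulVec]
  simp only [mul_one]
  rfl

end Compose

/-! ### The prefixed block circuit: assembly -/

section Block

variable {n L : ℕ} (A : Language Bool)

/-- **The final state of prefixed block `i`**: that of the original block for `preLang O`. [cite: RazTalJACM2022, §2.2, §6 and App. A] -/
theorem QlocP_mulVec_zero (i : Fin (rtBlocks n)) :
    (QlocP n L i).toMatrix A *ᵥ basisState (fun _ => false) =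
      invSqrt2 ^ (n + 2) • dState (cPre n L i) (blockAmp (cPre n L i) (preLang A)) := by
  have hsplit : (blockOpsP n L i).map (RtOp.map (foB n L)) =
      ((prefixOps n L i).map (ClOp.map (foB n L))).map RtOp.cl ++ (quantOpsP n L).map (RtOp.map (foB n L)) := by
    simp [blockOpsP, List.map_map, Function.comp_def, RtOp.map]
  unfold QlocP
  rw [RtOp.compileList_congr hsplit _ (fun op hop => (wf_map_finOf_of (Bsz_pos n L) (blockOpsP_wf (n := n) (L := L) i)
      (blockOpsP_lt (le_of_lt i.isLt))) op (hsplit ▸ hop)), RtOp.compileList_append, toMatrix_mk_append,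
    ← Matrix.mulVec_mulVec, compileList_map_cl_mulVec_basisState]
  have hcl : clEval ((prefixOps n L i).map (ClOp.map (foB n L))) (fun _ => false) = cPre n L i := by
    funext p
    rw [foB, clEval_map_finOf_apply (Bsz_pos n L) _ (fun op hop w hw => (prefixOps_wires (le_of_lt i.isLt) hop hw).2)]
    unfold cPre
    congr 1
    funext q
    simp [liftW]
  rw [hcl, compileList_quantOpsP_mulVec (cPre n L i) A (cPre_of_lt i) (cPre_fo i)]

/-- **The acceptance weights of prefixed block `i`**: the Born weight of `{half selector = 0}` is
`blockAcc n (blockWindow (preLang O) n L i)` and that of `{half selector = 1}` is `1 − blockAcc`.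
[cite: RazTalJACM2022, §6 and Claim 8.1] [cite: AaronsonAmbainis2018, Prop. 6] -/
theorem sum_ite_normSq_QlocP (i : Fin (rtBlocks n)) (b : Bool) :
    (∑ z : QReg (Bsz n L), if z (fh n L) = b then ‖((QlocP n L i).toMatrix A *ᵥ basisState (fun _ => false)) z‖ ^ 2 else 0) =
      if b then 1 - blockAcc n (blockWindow (preLang A) n L i) else blockAcc n (blockWindow (preLang A) n L i) := by
  rw [QlocP_mulVec_zero, sum_ite_normSq_final, cWindow_cPre, blockAcc]
  cases b
  · simp [sgn]
  · simp [sgn]; ring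

/-- **The block of the `1·`-window is the `1·`-window**: for `L = rtIdxBits n`, bit `k` of
`blockWindow (preLang O) n L i` is `[1 · rtAddr n i k ∈ O]`. [folklore] -/
theorem blockWindow_preLang (i : Fin (rtBlocks n)) (k : Fin (2 * 2 ^ n)) :
    blockWindow (preLang A) n (rtIdxBits n) i k = A.boolIndicator (true :: rtAddr n i k) := by
  rw [blockWindow, boolIndicator_preLang, rtAddr]

end Block

/-! ## II. `m` blocks, the threshold, the family (variant of `RazTalMaskedMachine.lean`) -/

section GProgram

variable (n : ℕ)

/-- **The prefixed blocks**: prefixed block `i` shifted to its wires. [cite: RazTalJACM2022, App. A] -/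
def blocksOpsP : List (RtOp ℕ) :=
  (List.range (rtBlocks n)).flatMap fun i => (blockOpsP n (rtL n) i).map (RtOp.map (· + blkBase n i))

/-- **The whole prefixed program at input length `n`.** [cite: RazTalJACM2022, App. A] -/
def allOpsP : List (RtOp ℕ) := (preOps n).map RtOp.cl ++ (blocksOpsP n ++ (postOps n).map RtOp.cl)

variable {n}

/-- The prefixed blocks are well formed. [folklore] -/
theorem blocksOpsP_wf : ∀ op ∈ blocksOpsP n, op.WF := by
  intro op hop
  simp only [blocksOpsP, List.mem_flatMap, List.mem_range, List.mem_map] at hop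
  obtain ⟨i, -, op, hop, rfl⟩ := hop
  exact (blockOpsP_wf i op hop).map_add _

/-- The wires of the prefixed blocks. [folklore] -/
theorem blocksOpsP_lt : ∀ op ∈ blocksOpsP n, ∀ w ∈ op.wires, w < rtW n := by
  intro op hop w hw
  simp only [blocksOpsP, List.mem_flatMap, List.mem_range, List.mem_map] at hop
  obtain ⟨i, hi, op', hop', rfl⟩ := hop
  rw [RtOp.wires_map] at hw
  obtain ⟨w', hw', rfl⟩ := List.mem_map.1 hw
  rw [add_comm]
  exact blkBase_add_lt hi (blockOpsP_lt hi.le op' hop' w' hw')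

/-- The whole prefixed program is well formed. [folklore] -/
theorem allOpsP_wf : ∀ op ∈ allOpsP n, op.WF := by
  intro op hop
  simp only [allOpsP, List.mem_append, List.mem_map] at hop
  rcases hop with ⟨op, hop, rfl⟩ | hop | ⟨op, hop, rfl⟩
  · exact preOps_wf op hop
  · exact blocksOpsP_wf op hop
  · exact postOps_wf op hop

/-- The wires of the whole prefixed program are below `rtW`. [folklore] -/
theorem allOpsP_lt : ∀ op ∈ allOpsP n, ∀ w ∈ op.wires, w < rtW n := by
  intro op hop
  simp only [allOpsP, List.mem_append, List.mem_map] at hop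
  rcases hop with ⟨op, hop, rfl⟩ | hop | ⟨op, hop, rfl⟩
  · exact preOps_lt op hop
  · exact blocksOpsP_lt op hop
  · exact postOps_lt op hop

variable (n)

/-- **The circuit of the prefixed Raz–Tal machine at input length `n`.** [cite: RazTalJACM2022, App. A] -/
def bigCircP : QCircuit cliffordT (rtW n) :=
  ⟨RtOp.compileList ((allOpsP n).map (RtOp.map (foW n))) (wf_map_finOf_of rtW_pos allOpsP_wf allOpsP_lt)⟩

end GProgram

/-! ### The prefixed blocks as embedded block circuits -/

section Blocks

variable {n : ℕ}

/-- The shifted prefixed block program through `foW` is the local one through the block embedding. [folklore] -/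
theorem blockOpsP_map_shift (i : Fin (rtBlocks n)) :
    ((blockOpsP n (rtL n) i).map (RtOp.map (· + blkBase n i))).map (RtOp.map (foW n)) =
      ((blockOpsP n (rtL n) i).map (RtOp.map (foB n (rtL n)))).map (RtOp.map (blkEmb n i)) := by
  rw [List.map_map, List.map_map]
  refine List.map_congr_left fun op hop => ?_
  simp only [Function.comp_apply, RtOp.map_map]
  refine RtOp.map_congr fun w hw => Fin.ext ?_
  have hwB : w < rtB n := blockOpsP_lt (le_of_lt i.isLt) op hop w hw
  simp only [Function.comp_apply, foW, val_blkEmb, foB, val_finOf_of_lt _ hwB,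
    val_finOf_of_lt _ (show w + blkBase n i < rtW n by rw [add_comm]; exact blkBase_add_lt i.isLt hwB)]
  ring

/-- **The compiled prefixed blocks segment is the concatenation of the embedded prefixed block circuits.** [folklore] -/
theorem compileList_blocksOpsP (h : ∀ op ∈ (blocksOpsP n).map (RtOp.map (foW n)), op.WF) :
    RtOp.compileList ((blocksOpsP n).map (RtOp.map (foW n))) h =
      (List.finRange (rtBlocks n)).flatMap fun i => (mapWires (blkEmb n i) (QlocP n (rtL n) i)).gates := by
  have hsplit : (blocksOpsP n).map (RtOp.map (foW n)) = (List.finRange (rtBlocks n)).flatMap fun i : Fin (rtBlocks n) =>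
      ((blockOpsP n (rtL n) i.val).map (RtOp.map (foB n (rtL n)))).map (RtOp.map (blkEmb n i)) := by
    rw [blocksOpsP, List.map_flatMap, range_eq_map_finRange, List.flatMap_map]
    congr 1
    funext i
    exact blockOpsP_map_shift i
  rw [RtOp.compileList_congr hsplit h (fun op hop => h op (hsplit ▸ hop))]
  suffices key : ∀ (l : List (Fin (rtBlocks n))) (hl : ∀ op ∈ l.flatMap (fun i : Fin (rtBlocks n) =>
      ((blockOpsP n (rtL n) i.val).map (RtOp.map (foB n (rtL n)))).map (RtOp.map (blkEmb n i))), op.WF),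
      RtOp.compileList _ hl = l.flatMap fun i => (mapWires (blkEmb n i) (QlocP n (rtL n) i)).gates from key _ _
  intro l hl
  induction l with
  | nil => rfl
  | cons i l ih =>
    conv_rhs => rw [List.flatMap_cons]
    rw [RtOp.compileList_congr List.flatMap_cons hl (fun op hop => hl op (by rw [List.flatMap_cons]; exact hop)),
      RtOp.compileList_append, ih]
    congr 1
    rw [← RtOp.compileList_map_embed (blkEmb n i) ((blockOpsP n (rtL n) i).map (RtOp.map (foB n (rtL n))))
      (wf_map_finOf_of (Bsz_pos _ _) (blockOpsP_wf (n := n) (L := rtL n) i) (blockOpsP_lt (le_of_lt i.isLt)))]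
    rfl

end Blocks

/-! ### The acceptance probability of the prefixed big circuit -/

section Accept

variable {n : ℕ} (A : Language Bool)

/-- The prefixed block states. [cite: RazTalJACM2022, App. A] -/
def blockStateP (i : Fin (rtBlocks n)) : QReg (rtB n) → ℂ := (QlocP n (rtL n) i).toMatrix A *ᵥ basisState fun _ => false

/-- **The state after the prefixed blocks** is the product state of the block states over `zPre`.
[cite: NielsenChuang2010, §2.1.7 eq. (2.45)] -/
theorem blocksP_mulVec (x : QReg n) (h : ∀ op ∈ (blocksOpsP n).map (RtOp.map (foW n)), op.WF) :
    (⟨RtOp.compileList ((blocksOpsP n).map (RtOp.map (foW n))) h⟩ : QCircuit cliffordT (rtW n)).toMatrix A *ᵥ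
      basisState (zPre x) = prodState (blkEmb n) (blockStateP A) (zPre x) := by
  have hz : ∀ i : Fin (rtBlocks n), zPre x ∘ blkEmb n i = fun _ => false := by
    intro i; funext p
    simp only [Function.comp_apply]
    refine zPre_of_le x _ (by simp; have := le_blkBase (n := n) i; omega) fun h' => ?_
    have := uW_lt_blkBase (n := n) (Nat.zero_le _) (Nat.zero_le _) i
    simp at h'; omega
  rw [compileList_blocksOpsP, basisState_eq_prodState (blkEmb n) (zPre x)]
  simp only [hz]
  exact toMatrix_flatMap_mapWires_mulVec_prodState A blockDisjoint_blkEmb (QlocP n (rtL n)) _ _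

/-- The block of the `1·`-window read by prefixed block `i` is block `i` of `pWindow`. [folklore] -/
theorem blockWindow_preLang_eq_pWindow (i : Fin (rtBlocks n)) :
    blockWindow (preLang A) n (rtL n) i = pWindow A n i := by
  funext k
  exact blockWindow_preLang A i k

/-- The Born weight of half selector `b` in prefixed block `i`. [cite: RazTalJACM2022, §6] -/
theorem blockStateP_weight (i : Fin (rtBlocks n)) (b : Bool) :
    (∑ v : QReg (rtB n), if v (fh n (rtL n)) = b then ‖blockStateP A i v‖ ^ 2 else 0) =
      if b then 1 - blockAcc n (pWindow A n i) else blockAcc n (pWindow A n i) := by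
  rw [blockStateP, sum_ite_normSq_QlocP, blockWindow_preLang_eq_pWindow]

/-- **The acceptance probability of the prefixed big circuit is `q1Accept` of the `1·`-window.**
[cite: RazTalJACM2022, App. A and Claim 8.1] -/
theorem acceptProb_bigCircP (x : QReg n) : (bigCircP n).acceptProb A x = q1Accept n (pWindow A n) := by
  classical
  have hsplit : (allOpsP n).map (RtOp.map (foW n)) =
      ((preOps n).map (ClOp.map (foW n))).map RtOp.cl ++ ((blocksOpsP n).map (RtOp.map (foW n)) ++
        ((postOps n).map (ClOp.map (foW n))).map RtOp.cl) := by
    simp [allOpsP, List.map_map, Function.comp_def, RtOp.map]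
  unfold QCircuit.acceptProb
  simp only [rtW_pos, dif_pos, QCircuit.runOn]
  unfold bigCircP
  rw [RtOp.compileList_congr hsplit _ (fun op hop => (wf_map_finOf_of rtW_pos allOpsP_wf allOpsP_lt) op (hsplit ▸ hop)),
    RtOp.compileList_append, RtOp.compileList_append, toMatrix_mk_append, toMatrix_mk_append, Matrix.mul_assoc,
    ← Matrix.mulVec_mulVec, ← Matrix.mulVec_mulVec, pre_mulVec, blocksP_mulVec]
  rw [sum_ite_normSq_mulVec_of_perm ⟨_, post_injective⟩ (post_mulVec_basisState A _) _ (fun y => y ⟨0, rtW_pos⟩ = true)]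
  simp only [Function.Embedding.coeFn_mk]
  set Ψ := prodState (blkEmb n) (blockStateP A) (zPre x) with hΨ
  set g : (Fin (rtBlocks n) → QReg (rtB n)) → ℝ := fun y =>
    if rtThreshold n ≤ (Finset.univ.filter fun i => y i (fh n (rtL n)) = false).card then 1 else 0 with hg
  have hsupp : ∀ z, (if clEval ((postOps n).map (ClOp.map (foW n))) z ⟨0, rtW_pos⟩ = true then ‖Ψ z‖ ^ 2 else 0) =
      ‖Ψ z‖ ^ 2 * g (fun i => z ∘ blkEmb n i) := by
    intro z
    by_cases hz : ∀ w, OffBlocks (blkEmb n) w → z w = zPre x w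
    · rw [post_zero x z hz, hg]
      simp only [Function.comp_apply, decide_eq_true_eq]
      split <;> simp
    · have h0 : Ψ z = 0 := by rw [hΨ, prodState_apply, if_neg hz, zero_mul]
      simp [h0]
  simp_rw [hsupp]
  rw [sum_normSq_prodState_mul blockDisjoint_blkEmb]
  have hreg : ∀ y : Fin (rtBlocks n) → QReg (rtB n), (∏ i, ‖blockStateP A i (y i)‖ ^ 2) * g y =
      ∑ b : Fin (rtBlocks n) → Bool, (if rtThreshold n ≤ (Finset.univ.filter fun i => b i = false).card then (1 : ℝ) else 0) *
        ∏ i, (if y i (fh n (rtL n)) = b i then ‖blockStateP A i (y i)‖ ^ 2 else 0) := by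
    intro y
    rw [Finset.sum_eq_single (fun i => y i (fh n (rtL n)))]
    · rw [hg, mul_comm]
      simp
    · intro b _ hb
      rw [Finset.prod_ite_zero, if_neg (fun h : ∀ i ∈ Finset.univ, y i (fh n (rtL n)) = b i =>
        hb (funext fun i => (h i (Finset.mem_univ i)).symm)), mul_zero]
    · intro h; exact absurd (Finset.mem_univ _) h
  simp_rw [hreg]
  rw [Finset.sum_comm]
  simp_rw [← Finset.mul_sum]
  have hprod : ∀ b : Fin (rtBlocks n) → Bool,
      (∑ y : Fin (rtBlocks n) → QReg (rtB n), ∏ i, (if y i (fh n (rtL n)) = b i then ‖blockStateP A i (y i)‖ ^ 2 else 0)) =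
        ∏ i, (if b i then 1 - blockAcc n (pWindow A n i) else blockAcc n (pWindow A n i)) := by
    intro b
    have := Finset.prod_univ_sum (fun _ : Fin (rtBlocks n) => (Finset.univ : Finset (QReg (rtB n))))
      (fun i v => if v (fh n (rtL n)) = b i then ‖blockStateP A i v‖ ^ 2 else 0)
    rw [Fintype.piFinset_univ] at this
    rw [← this]
    exact Finset.prod_congr rfl fun i _ => blockStateP_weight A i (b i)
  simp_rw [hprod]
  unfold q1Accept runPattern
  rw [← Fintype.sum_equiv (patternEquiv (rtBlocks n)) _ _ (fun b => rfl)]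
  refine Finset.sum_congr rfl fun b _ => ?_
  simp only [patternEquiv, Equiv.coe_fn_mk, Finset.mem_filter, Finset.mem_univ, true_and]
  split
  · rw [one_mul]
    refine Finset.prod_congr rfl fun i _ => ?_
    cases b i <;> simp
  · rw [zero_mul]

end Accept

/-! ### The family -/

section Family

variable (n : ℕ)

/-- **The prefixed Raz–Tal family** with threshold `n₀` and table `tbl`. [cite: RazTalJACM2022, App. A] -/
def rtFamilyP (n₀ : ℕ) (tbl : ℕ → Bool) : QCircuitFamily cliffordT :=
  ⟨rtAnc, fun n => if n < n₀ then smallCirc n (tbl n) else bigCircP n⟩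

variable {n}

/-- Below `n₀` the prefixed family accepts with probability `tbl |x|`. [cite: RazTalJACM2022, App. A] -/
theorem acceptProbOn_rtFamilyP_of_lt (n₀ : ℕ) (tbl : ℕ → Bool) (A : Language Bool) (x : List Bool) (hx : x.length < n₀) :
    (rtFamilyP n₀ tbl).acceptProbOn A x = if tbl x.length then 1 else 0 := by
  unfold QCircuitFamily.acceptProbOn rtFamilyP
  simp only [hx, ↓reduceIte]
  exact acceptProb_smallCirc A (tbl x.length) x.get

/-- From `n₀` on the prefixed family accepts with probability `q1Accept |x|` of the `1·`-window.
[cite: RazTalJACM2022, App. A and Claim 8.1] -/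
theorem acceptProbOn_rtFamilyP_of_le (n₀ : ℕ) (tbl : ℕ → Bool) (A : Language Bool) (x : List Bool) (hx : n₀ ≤ x.length) :
    (rtFamilyP n₀ tbl).acceptProbOn A x = q1Accept x.length (pWindow A x.length) := by
  unfold QCircuitFamily.acceptProbOn rtFamilyP
  simp only [not_lt.2 hx, ↓reduceIte]
  exact acceptProb_bigCircP A x.get

/-- **The prefixed machine from the uniformity of the prefixed family.** [cite: RazTalJACM2022, App. A] -/
theorem prefixedMachine_of_isUniform (hU : ∀ (n₀ : ℕ) (tbl : ℕ → Bool), (rtFamilyP n₀ tbl).IsUniform)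
    (n₀ : ℕ) (tbl : ℕ → Bool) :
    ∃ F : QCircuitFamily cliffordT, F.IsUniform ∧
      ∀ (A : Language Bool) (x : List Bool),
        (x.length < n₀ → F.acceptProbOn A x = if tbl x.length then 1 else 0) ∧
        (n₀ ≤ x.length → F.acceptProbOn A x = q1Accept x.length (pWindow A x.length)) :=
  ⟨rtFamilyP n₀ tbl, hU n₀ tbl, fun A x =>
    ⟨fun hx => acceptProbOn_rtFamilyP_of_lt n₀ tbl A x hx, fun hx => acceptProbOn_rtFamilyP_of_le n₀ tbl A x hx⟩⟩

end Family

/-! ## III. Uniformity (variant of `RazTalMaskedUniform.lean`) -/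

section Uniform

open RevDesc RevSim
open Complexity.SProg (dbl dbl_nil dbl_cons)

/-- **The description of the prefixed big circuit is the concatenation of the `RtOp.bits` of `allOpsP`.**
[Arora–Barak 2009, §6.1] [folklore] -/
theorem encode_bigCircP (n : ℕ) : QCircuit.encode (bigCircP n) = (allOpsP n).flatMap RtOp.bits := by
  rw [bigCircP, encode_eq_flatMap]
  exact flatMap_gateEnc_compileList rtW_pos (allOpsP n) allOpsP_lt _

namespace RtGen

attribute [local simp] GExpr.eval

/-- **the prefixed oracle query of the current block** (query wires: seed, address, index bits). [folklore] -/
def oracleGP : GS :=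
  .seq (.emit (litT [true, true]))
  (.seq (ticksG (.add (.add nE (.const 2)) LE))
  (.seq (.emit (Tok.dump true true :: litT [false, false, true, true]))
  (.seq (.loop .cc (.mul (.const 4) (.add (.add (.add nE (.const 2)) LE) (.const 1))) (.emit [Tok.lit true]))
  (.seq (.emit (litT [false, false, true, true]))
  (.seq (wireG (sh oWL))
  (.seq (.loop .ll (.add nE (.const 1)) (wireG (sh (.var .ll))))
  (.seq (.loop .ll LE (wireG (sh (bWL (.var .ll)))))
  (.seq (wireG (sh tWL)) (.emit (litT [false, true]))))))))))

/-- **one prefixed block** (`blockOpsP` shifted to the current block). [folklore] -/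
def blockGP : GS :=
  .seq (opG (ClOp.not (sh oWL)))
  (.seq (.loop .rr (.var .bi) incrG)
  (.seq (opG (ClOp.not (sh tWL)))
  (.seq (hadG (sh tWL))
  (.seq (.loop .ll (.add nE (.const 1)) (hadG (sh (.var .ll))))
  (.seq oracleGP
  (.seq (.loop .ll nE (chadG (sh nE) (sh (.var .ll))))
    (hadG (sh nE))))))))

/-- **The generator program of the prefixed Raz–Tal family** (big circuits). [Arora–Barak 2009, §6.2 and proof of Thm. 6.15] [folklore] -/
def descGP : GS :=
  .seq headerG (.seq preG (.seq (.loop .bi mE blockGP) postG))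

variable {env : RV → ℕ}

/-- **The prefixed oracle generator prints the shifted prefixed oracle query.** [folklore] -/
theorem out_oracleGP (hL : env .xL = rtL (env .xn)) :
    oracleGP.out env = (RtOp.oracle ((queryWiresP (env .xn) (env .xL)).map (· + blkBase (env .xn) (env .bi)))
      (tW (env .xn) + blkBase (env .xn) (env .bi))).toks := by
  have hxl : ∀ j, Function.update env RV.ll j RV.xn = env .xn := fun j => by simp
  have hLl : ∀ j, Function.update env RV.ll j RV.xL = env .xL := fun j => by simp
  have hblk : ∀ j, (blkE (.var .bi)).eval (Function.update env .ll j) = blkBase (env .xn) (env .bi) := fun j => by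
    rw [eval_blkE _ _ (by rw [hLl, hxl]; exact hL)]; simp
  have hblk0 : (blkE (.var .bi)).eval env = blkBase (env .xn) (env .bi) := by rw [eval_blkE _ _ hL]; simp
  simp only [oracleGP, GStmt.out, out_ticksG, out_wireG, GExpr.eval, nE, LE, sh, hxl, Function.update_self, hblk, hblk0,
    eval_bWL, eval_tWL, eval_oWL, flatMap_range_const, RtOp.toks, oracleToks, queryWiresP, queryWires, List.length_map,
    List.length_append, List.length_range, List.length_cons, List.map_append, List.map_cons, List.map_map,
    List.flatMap_append, List.flatMap_cons, List.flatMap_map, List.append_assoc, List.cons_append]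
  simp [litT]
  ring_nf

/-- **The prefixed block generator prints the shifted prefixed block program.** [folklore] -/
theorem out_blockGP (hL : env .xL = rtL (env .xn)) :
    blockGP.out env = ((blockOpsP (env .xn) (env .xL) (env .bi)).map (RtOp.map (· + blkBase (env .xn) (env .bi)))).flatMap
      RtOp.toks := by
  have hxr : ∀ j, Function.update env RV.rr j RV.xn = env .xn := fun j => by simp
  have hLr : ∀ j, Function.update env RV.rr j RV.xL = env .xL := fun j => by simp
  have hbr : ∀ j, Function.update env RV.rr j RV.bi = env .bi := fun j => by simp
  have hxl : ∀ j, Function.update env RV.ll j RV.xn = env .xn := fun j => by simp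
  have hLl : ∀ j, Function.update env RV.ll j RV.xL = env .xL := fun j => by simp
  have hblk : ∀ j, (blkE (.var .bi)).eval (Function.update env .ll j) = blkBase (env .xn) (env .bi) := fun j => by
    rw [eval_blkE _ _ (by rw [hLl, hxl]; exact hL)]; simp
  have hblk0 : (blkE (.var .bi)).eval env = blkBase (env .xn) (env .bi) := by rw [eval_blkE _ _ hL]; simp
  have hinc : ∀ k, incrG.out (Function.update env .rr k) = (incrOps (env .xn) (env .xL) k).flatMap
      fun op => (RtOp.cl (op.map (· + blkBase (env .xn) (env .bi)))).toks := fun k => by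
    rw [out_incrG (by rw [hLr, hxr]; exact hL)]; simp
  simp only [blockGP, GStmt.out, out_opG, out_hadG, out_chadG, hinc, out_oracleGP hL, GExpr.eval, nE, sh, hxl,
    Function.update_self, hblk, hblk0, eval_tWL, blockOpsP, prefixOps, quantOpsP, List.map_append, List.map_cons,
    List.map_map, List.flatMap_append, List.flatMap_cons, List.flatMap_map, List.map_flatMap, List.flatMap_assoc,
    List.append_assoc, List.nil_append, List.cons_append, List.flatMap_nil, List.map_nil]
  simp [hW, hblk0]

/-- **The prefixed generator prints the header followed by the tokens of the whole prefixed program.** [folklore] -/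
theorem out_descGP (n : ℕ) :
    descGP.out (GenProg.initEnv₂ .xn .xL n (rtL n)) = headerToks n (rtAnc n) ++ (allOpsP n).flatMap RtOp.toks := by
  set env₀ := GenProg.initEnv₂ RV.xn RV.xL n (rtL n) with henv
  have hn : env₀ .xn = n := by simp [henv, GenProg.initEnv₂]
  have hLv : env₀ .xL = rtL n := by simp [henv, GenProg.initEnv₂]
  have hL : env₀ .xL = rtL (env₀ .xn) := by rw [hn, hLv]
  have hxb : ∀ j, Function.update env₀ RV.bi j RV.xn = n := fun j => by simp [hn]
  have hLb : ∀ j, Function.update env₀ RV.bi j RV.xL = rtL n := fun j => by simp [hLv]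
  have hblk : ∀ j, blockGP.out (Function.update env₀ .bi j) =
      ((blockOpsP n (rtL n) j).map (RtOp.map (· + blkBase n j))).flatMap RtOp.toks := fun j => by
    rw [out_blockGP (by rw [hLb, hxb])]; simp [hn, hLv]
  simp only [descGP, GStmt.out, out_headerG hL, out_preG, out_postG hL, hn, eval_mE, hblk, allOpsP, blocksOpsP,
    List.flatMap_append]
  rw [List.flatMap_assoc]

/-- **The prefixed generator renders the description of the prefixed big circuit.**
[Arora–Barak 2009, §6.2 and proof of Thm. 6.15] [folklore] -/
theorem render_out_descGP (n : ℕ) :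
    Tok.render 0 (descGP.out (GenProg.initEnv₂ .xn .xL n (rtL n))) = QCircuit.sigmaEncode ⟨n, rtAnc n, bigCircP n⟩ := by
  rw [out_descGP, render_headerToks, ← List.append_nil ((allOpsP n).flatMap RtOp.toks), render_flatMap_rtoks, Tok.render_nil,
    List.append_nil, ← encode_bigCircP]
  change _ = boolPair (encodeNat n) (boolPair (unaryEncodeNat (rtAnc n)) (QCircuit.encode (bigCircP n)))
  rw [RevDesc.boolPair_eq, RevDesc.boolPair_eq, RevDesc.unaryEncodeNat_eq_replicate, dbl_replicate]
  simp

/-- The input variable `xn` is not a loop variable of the prefixed generator. [folklore] -/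
theorem xn_not_mem_loopVars_descGP : RV.xn ∉ descGP.loopVars := by decide

/-- The input variable `xL` is not a loop variable of the prefixed generator. [folklore] -/
theorem xL_not_mem_loopVars_descGP : RV.xL ∉ descGP.loopVars := by decide

/-- The prefixed generator does not reuse loop variables. [folklore] -/
theorem noReuse_descGP : descGP.noReuse = true := by decide

/-- **The description of the prefixed big circuits is in `FP`.** [Arora–Barak 2009, §6.2 and proof of Thm. 6.15] [folklore] -/
theorem descBigP_mem_FP :
    (fun z : List Bool => QCircuit.sigmaEncode (G := cliffordT) ⟨z.length, rtAnc z.length, bigCircP z.length⟩) ∈ FP := by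
  have hpre := GStmt.render_out_mem_FP pre1G .xn pre1G_hygiene.1 pre1G_hygiene.2
  have hgen := GStmt.render_out₂_mem_FP descGP .xn .xL xn_not_mem_loopVars_descGP xL_not_mem_loopVars_descGP noReuse_descGP
  have h := comp_mem_FP hgen hpre
  have e : ((fun w => Tok.render 0 (descGP.out (GenProg.parseEnv RV.xn RV.xL (fun _ => 0) w))) ∘ fun z : List Bool =>
      Tok.render 0 (pre1G.out (GenProg.initEnv RV.xn z.length))) =
      fun z : List Bool => QCircuit.sigmaEncode (G := cliffordT) ⟨z.length, rtAnc z.length, bigCircP z.length⟩ := by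
    funext z
    simp only [Function.comp_apply]
    rw [render_out_pre1G, GenProg.parseEnv_replicate (by decide), TM2Pass.length_encodeNat_eq_size]
    exact render_out_descGP z.length
  rwa [e] at h

end RtGen

open RtGen in
/-- **The prefixed Raz–Tal family is polynomial-time uniform.** [cite: RazTalJACM2022, App. A] -/
theorem rtFamilyP_isUniform (n₀ : ℕ) (tbl : ℕ → Bool) : (rtFamilyP n₀ tbl).IsUniform := by
  refine QCircuitFamily.isUniform_of_mem_FP _ (mem_FP_of_eqOn_le descBigP_mem_FP n₀ fun z hz => ?_)
  simp [rtFamilyP, not_lt.2 hz]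

end Uniform

end RazTalMachine

open RazTalMachine in

/-- **The uniform `BQP^O` machine running Raz–Tal's `Q₁` on the `1·`-window**: for every threshold
`n₀` and table `tbl`, a polynomial-time uniform family of Clifford+T circuits with oracle gates which
accepts `x` with probability `tbl |x|` below `n₀` and with probability exactly
`q1Accept |x| (pWindow O |x|) = q1Accept |x| (rtWindow (preLang O) |x|)` from `n₀` on.
[cite: RazTalJACM2022, App. A] -/
theorem razTalPrefixed_bqpMachine (n₀ : ℕ) (tbl : ℕ → Bool) :
    ∃ F : QCircuitFamily cliffordT, F.IsUniform ∧
      ∀ (A : Language Bool) (x : List Bool),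
        (x.length < n₀ → F.acceptProbOn A x = if tbl x.length then 1 else 0) ∧
        (n₀ ≤ x.length → F.acceptProbOn A x = q1Accept x.length (pWindow A x.length)) :=
  prefixedMachine_of_isUniform rtFamilyP_isUniform n₀ tbl

end Literature.Computability.QuantumComplexity

end
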